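import Mathlib

/-!
# IsoCensus — the finite census behind PROP ISO and REMARK S7 (solo-blind s75/s76)

Solo-blind programme, `work/s75/cm-catalogue.md` §2 (PROP ISO (a), (c), (d), (e)) and §5 (REMARK S7);
claims SB-C664, SB-C668, SB-C669.

Informal setting (nothing geometric is formalised here).  A jacobian elliptic K3 surface with constant
modulus `j = 0` has a minimal Weierstrass model `y² = x³ + b(t)`, `b` a binary form of degree `12`
whose roots have multiplicities `k ∈ {1,…,5}` (fibres `II, IV, I₀*, IV*, II*`); for `j = 1728` the
model is `y² = x³ + a(t)·x`, `deg a = 8`, multiplicities `k ∈ {1,2,3}` (fibres `III, I₀*, III*`).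
With `s` the number of distinct roots the very general member has `rk T = 2s - 4`, `m = s - 2`, and the
strata of the isotrivial locus are indexed by the root-multiplicity partitions (PROP ISO (c), (d)).

What this file certifies (closed computations only — `decide`, `omega`, small inductions):

* `kodaira_j0` / `kodaira_j1728` : the Tate table used in ISO (a), read off the standard
  (Euler number, number of components) table of the seven additive Kodaira types with potentially
  good reduction: over a root of multiplicity `k` the fibre has `e = 2k` (resp. `3k`) and contributes
  `2(k-1)` (resp. `3k-2`) to the rank of the trivial lattice;
* `trivial_rank_j0` / `trivial_rank_j1728` : hence `ρ_triv = 2 + Σ = 26 - 2s` and `e = 24` in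
  both cases, for every admissible multiplicity list;
* `range_j0` / `range_j1728` : a stratum with `s` distinct roots exists iff `3 ≤ s ≤ 12`
  (resp. `3 ≤ s ≤ 8`), i.e. `m = s - 2` ranges over `1..10` (resp. `1..6`);
* `census6_j0` (+ `census6_j0_sound`) : at `s = 6` (`m = 4`) the partitions of `12` into six parts
  `≤ 5` are EXACTLY the nine of PROP ISO (d); `census6_j1728` (+ `_sound`) : the partitions of `8`
  into six parts `≤ 3` are exactly two;
* `census6_j0_noI0star` : exactly four of the nine have no part `3` (no `I₀*` fibre), i.e.
  `rk S(σ₃)^⊥ = 2m + 2n₃ = 8` (ISO (e)) — the `(X, σ₃)` matched with the order-three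
  classification in PROP GP3;
* `census7_j0` / `census7_j1728` (+ `_sound`) : at `s = 7` (`m = 5`, REMARK S7) there are exactly
  six `j = 0` strata and one `j = 1728` stratum, each of dimension `s - 3 = 4`.

Bookkeeping only: no statement about surfaces, Hodge classes or the summit is made or implied.
-/

set_option linter.dupNamespace false
-- the nested bounded quantifiers of the census theorems need a larger instance-synthesis budget
set_option synthInstance.maxSize 8192
set_option synthInstance.maxHeartbeats 400000

namespace Summit.HodgeConjecture.HodgeConjecture.Theorems.IsoCensus

/-! ## The Tate table for constant `j ∈ {0, 1728}` -/

/-- The seven additive Kodaira types with potentially good reduction. -/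
inductive Kod | II | III | IV | I0s | IVs | IIIs | IIs
  deriving DecidableEq, Repr

namespace Kod

/-- Euler number `e(F)` of the fibre (equal to `ord Δ` for these types). -/
def euler : Kod → ℕ
  | II => 2 | III => 3 | IV => 4 | I0s => 6 | IVs => 8 | IIIs => 9 | IIs => 10

/-- Number of irreducible components of the fibre. -/
def comp : Kod → ℕ
  | II => 1 | III => 2 | IV => 3 | I0s => 5 | IVs => 7 | IIIs => 8 | IIs => 9

end Kod

/-- `j = 0`, `y² = x³ + b(t)`: the fibre over a root of `b` of multiplicity `k = 1,…,5`
(`ord Δ = 2k`; `k = 6` would be non-minimal).  Values outside `1..5` are junk. -/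
def fibJ0 : ℕ → Kod
  | 1 => .II | 2 => .IV | 3 => .I0s | 4 => .IVs | 5 => .IIs | _ => .II

/-- `j = 1728`, `y² = x³ + a(t)·x`: the fibre over a root of `a` of multiplicity `k = 1,2,3`
(`ord Δ = 3k`; `k = 4` would be non-minimal).  Values outside `1..3` are junk. -/
def fibJ1728 : ℕ → Kod
  | 1 => .III | 2 => .I0s | 3 => .IIIs | _ => .III

/-- ISO (a), `j = 0`: `e = 2k` and the trivial-lattice contribution is `#components - 1 = 2(k-1)`. -/
theorem kodaira_j0 :
    ∀ k ≤ 5, 1 ≤ k → (fibJ0 k).euler = 2 * k ∧ (fibJ0 k).comp - 1 = 2 * (k - 1) := by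
  decide

/-- ISO (a), `j = 1728`: `e = 3k` and the trivial-lattice contribution is `#components - 1 = 3k-2`. -/
theorem kodaira_j1728 :
    ∀ k ≤ 3, 1 ≤ k → (fibJ1728 k).euler = 3 * k ∧ (fibJ1728 k).comp - 1 = 3 * k - 2 := by
  decide

/-! ## `ρ_triv = 26 - 2s` -/

/-- `Σ c·k = c·Σ k` over a list of naturals. -/
theorem sum_map_const_mul (c : ℕ) (l : List ℕ) : (l.map fun k => c * k).sum = c * l.sum := by
  induction l with
  | nil => simp
  | cons a t ih => simp [ih, mul_add]

/-- Over a list of multiplicities `k ≥ 1`: `Σ 2(k-1) + 2s = 2 Σk`. -/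
theorem sum_contrib_j0 (l : List ℕ) (h : ∀ k ∈ l, 1 ≤ k) :
    (l.map fun k => 2 * (k - 1)).sum + 2 * l.length = 2 * l.sum := by
  induction l with
  | nil => simp
  | cons a t ih =>
    have ha : 1 ≤ a := h a (by simp)
    have ht : ∀ k ∈ t, 1 ≤ k := fun k hk => h k (by simp [hk])
    specialize ih ht
    simp only [List.map_cons, List.sum_cons, List.length_cons]
    omega

/-- Over a list of multiplicities `k ≥ 1`: `Σ (3k-2) + 2s = 3 Σk`. -/
theorem sum_contrib_j1728 (l : List ℕ) (h : ∀ k ∈ l, 1 ≤ k) :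
    (l.map fun k => 3 * k - 2).sum + 2 * l.length = 3 * l.sum := by
  induction l with
  | nil => simp
  | cons a t ih =>
    have ha : 1 ≤ a := h a (by simp)
    have ht : ∀ k ∈ t, 1 ≤ k := fun k hk => h k (by simp [hk])
    specialize ih ht
    simp only [List.map_cons, List.sum_cons, List.length_cons]
    omega

/-- PROP ISO (a), `j = 0`: for the root-multiplicity list of a degree-`12` form with `s` distinct roots
the trivial lattice has rank `2 + Σ 2(k-1) = 26 - 2s`, and `e = Σ 2k = 24`. -/
theorem trivial_rank_j0 (l : List ℕ) (h : ∀ k ∈ l, 1 ≤ k) (hs : l.sum = 12) :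
    2 + (l.map fun k => 2 * (k - 1)).sum = 26 - 2 * l.length ∧
      (l.map fun k => 2 * k).sum = 24 := by
  have h1 := sum_contrib_j0 l h
  refine ⟨by omega, ?_⟩
  rw [sum_map_const_mul, hs]

/-- PROP ISO (a), `j = 1728`: for the root-multiplicity list of a degree-`8` form with `s` distinct
roots the trivial lattice has rank `2 + Σ (3k-2) = 26 - 2s`, and `e = Σ 3k = 24`. -/
theorem trivial_rank_j1728 (l : List ℕ) (h : ∀ k ∈ l, 1 ≤ k) (hs : l.sum = 8) :
    2 + (l.map fun k => 3 * k - 2).sum = 26 - 2 * l.length ∧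
      (l.map fun k => 3 * k).sum = 24 := by
  have h1 := sum_contrib_j1728 l h
  refine ⟨by omega, ?_⟩
  rw [sum_map_const_mul, hs]

/-! ## The range of `s` (PROP ISO (c)) -/

/-- A list of naturals in `[1, B]` has `length ≤ sum ≤ B · length`. -/
theorem length_bounds (l : List ℕ) (B : ℕ) (h : ∀ k ∈ l, 1 ≤ k ∧ k ≤ B) :
    l.length ≤ l.sum ∧ l.sum ≤ B * l.length := by
  induction l with
  | nil => simp
  | cons a t ih =>
    have ha := h a (by simp)
    have ht : ∀ k ∈ t, 1 ≤ k ∧ k ≤ B := fun k hk => h k (by simp [hk])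
    obtain ⟨h1, h2⟩ := ih ht
    refine ⟨?_, ?_⟩
    · simp only [List.length_cons, List.sum_cons]; omega
    · simp only [List.length_cons, List.sum_cons]
      calc a + t.sum ≤ B + B * t.length := Nat.add_le_add ha.2 h2
        _ = B * (t.length + 1) := by ring

/-- PROP ISO (c), `j = 0`: a stratum with `s` distinct roots (multiplicities in `[1,5]`, total `12`)
exists iff `3 ≤ s ≤ 12`; so `m = s - 2 ∈ [1,10]`. -/
theorem range_j0 (s : ℕ) :
    (∃ l : List ℕ, l.length = s ∧ (∀ k ∈ l, 1 ≤ k ∧ k ≤ 5) ∧ l.sum = 12) ↔ 3 ≤ s ∧ s ≤ 12 := by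
  constructor
  · rintro ⟨l, rfl, hb, hs⟩
    have := length_bounds l 5 hb
    omega
  · rintro ⟨h3, h12⟩
    interval_cases s
    · exact ⟨[5, 5, 2], rfl, by decide, by decide⟩
    · exact ⟨[5, 5, 1, 1], rfl, by decide, by decide⟩
    · exact ⟨[5, 4, 1, 1, 1], rfl, by decide, by decide⟩
    · exact ⟨[5, 3, 1, 1, 1, 1], rfl, by decide, by decide⟩
    · exact ⟨[5, 2, 1, 1, 1, 1, 1], rfl, by decide, by decide⟩
    · exact ⟨[5, 1, 1, 1, 1, 1, 1, 1], rfl, by decide, by decide⟩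
    · exact ⟨[4, 1, 1, 1, 1, 1, 1, 1, 1], rfl, by decide, by decide⟩
    · exact ⟨[3, 1, 1, 1, 1, 1, 1, 1, 1, 1], rfl, by decide, by decide⟩
    · exact ⟨[2, 1, 1, 1, 1, 1, 1, 1, 1, 1, 1], rfl, by decide, by decide⟩
    · exact ⟨[1, 1, 1, 1, 1, 1, 1, 1, 1, 1, 1, 1], rfl, by decide, by decide⟩

/-- PROP ISO (c), `j = 1728`: a stratum with `s` distinct roots (multiplicities in `[1,3]`, total `8`)
exists iff `3 ≤ s ≤ 8`; so `m = s - 2 ∈ [1,6]`. -/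
theorem range_j1728 (s : ℕ) :
    (∃ l : List ℕ, l.length = s ∧ (∀ k ∈ l, 1 ≤ k ∧ k ≤ 3) ∧ l.sum = 8) ↔ 3 ≤ s ∧ s ≤ 8 := by
  constructor
  · rintro ⟨l, rfl, hb, hs⟩
    have := length_bounds l 3 hb
    omega
  · rintro ⟨h3, h8⟩
    interval_cases s
    · exact ⟨[3, 3, 2], rfl, by decide, by decide⟩
    · exact ⟨[3, 3, 1, 1], rfl, by decide, by decide⟩
    · exact ⟨[3, 2, 1, 1, 1], rfl, by decide, by decide⟩
    · exact ⟨[3, 1, 1, 1, 1, 1], rfl, by decide, by decide⟩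
    · exact ⟨[2, 1, 1, 1, 1, 1, 1], rfl, by decide, by decide⟩
    · exact ⟨[1, 1, 1, 1, 1, 1, 1, 1], rfl, by decide, by decide⟩

/-! ## The census at `s = 6` (`m = 4`; PROP ISO (d)) -/

/-- The nine root-multiplicity partitions at `s = 6`, `j = 0`, as descending lists:
`{2⁶}` (six `IV`; the family of COR Z22), `{1²,2³,4}`, `{1⁴,4²}`, `{1³,2²,5}` (no `I₀*` fibre), and
`{1,2⁴,3}`, `{1²,2²,3²}`, `{1³,2,3,4}`, `{1³,3³}`, `{1⁴,3,5}` (with `I₀*` fibres). -/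
def strata6J0 : List (List ℕ) :=
  [[2, 2, 2, 2, 2, 2], [4, 2, 2, 2, 1, 1], [4, 4, 1, 1, 1, 1], [5, 2, 2, 1, 1, 1],
   [3, 2, 2, 2, 2, 1], [3, 3, 2, 2, 1, 1], [4, 3, 2, 1, 1, 1], [3, 3, 3, 1, 1, 1],
   [5, 3, 1, 1, 1, 1]]

/-- Completeness: every descending six-tuple of integers in `[1,5]` with sum `12` is one of the nine. -/
theorem census6_j0 :
    ∀ a ≤ 5, ∀ b ≤ a, ∀ c ≤ b, ∀ d ≤ c, ∀ e ≤ d, ∀ f ≤ e, 1 ≤ f →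
      a + b + c + d + e + f = 12 → [a, b, c, d, e, f] ∈ strata6J0 := by
  decide

/-- Soundness: the nine are pairwise distinct descending six-tuples in `[1,5]` with sum `12`. -/
theorem census6_j0_sound :
    strata6J0.length = 9 ∧ strata6J0.Nodup ∧
      ∀ l ∈ strata6J0, l.length = 6 ∧ l.Pairwise (· ≥ ·) ∧ (∀ k ∈ l, 1 ≤ k ∧ k ≤ 5) ∧
        l.sum = 12 := by
  decide

/-- ISO (e) / PROP GP3: the strata without an `I₀*` fibre (no part `3`, `n₃ = 0`, hence
`rk S(σ₃)^⊥ = 2m + 2n₃ = 8`) are exactly `{2⁶}`, `{1²,2³,4}`, `{1⁴,4²}`, `{1³,2²,5}`. -/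
theorem census6_j0_noI0star :
    strata6J0.filter (fun l => decide (3 ∉ l)) =
      [[2, 2, 2, 2, 2, 2], [4, 2, 2, 2, 1, 1], [4, 4, 1, 1, 1, 1], [5, 2, 2, 1, 1, 1]] := by
  decide

/-- ISO (e): on each of the nine strata `rk S(σ₃)^⊥ = 2m + 2n₃ = 8 + 2·#{parts = 3}` takes the values
`8, 8, 8, 8, 10, 12, 10, 14, 10`. -/
theorem census6_j0_coinvariant_ranks :
    strata6J0.map (fun l => 8 + 2 * l.count 3) = [8, 8, 8, 8, 10, 12, 10, 14, 10] := by
  decide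

/-- The two root-multiplicity partitions at `s = 6`, `j = 1728`: `{1⁴,2²}` (`4·III + 2·I₀*`) and
`{1⁵,3}` (`5·III + III*`). -/
def strata6J1728 : List (List ℕ) :=
  [[2, 2, 1, 1, 1, 1], [3, 1, 1, 1, 1, 1]]

/-- Completeness at `s = 6`, `j = 1728`. -/
theorem census6_j1728 :
    ∀ a ≤ 3, ∀ b ≤ a, ∀ c ≤ b, ∀ d ≤ c, ∀ e ≤ d, ∀ f ≤ e, 1 ≤ f →
      a + b + c + d + e + f = 8 → [a, b, c, d, e, f] ∈ strata6J1728 := by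
  decide

/-- Soundness at `s = 6`, `j = 1728`. -/
theorem census6_j1728_sound :
    strata6J1728.length = 2 ∧ strata6J1728.Nodup ∧
      ∀ l ∈ strata6J1728, l.length = 6 ∧ l.Pairwise (· ≥ ·) ∧ (∀ k ∈ l, 1 ≤ k ∧ k ≤ 3) ∧
        l.sum = 8 := by
  decide

/-! ## The census at `s = 7` (`m = 5`; REMARK S7) -/

/-- The six root-multiplicity partitions at `s = 7`, `j = 0`:
`{1²,2⁵}` (the Dolgachev–van Geemen–Kondō surface `X_S` of ID5), `{1³,2³,3}`, `{1⁴,2,3²}`,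
`{1⁴,2²,4}`, `{1⁵,3,4}`, `{1⁵,2,5}`. -/
def strata7J0 : List (List ℕ) :=
  [[2, 2, 2, 2, 2, 1, 1], [3, 2, 2, 2, 1, 1, 1], [3, 3, 2, 1, 1, 1, 1], [4, 2, 2, 1, 1, 1, 1],
   [4, 3, 1, 1, 1, 1, 1], [5, 2, 1, 1, 1, 1, 1]]

/-- Completeness at `s = 7`, `j = 0`. -/
theorem census7_j0 :
    ∀ a ≤ 5, ∀ b ≤ a, ∀ c ≤ b, ∀ d ≤ c, ∀ e ≤ d, ∀ f ≤ e, ∀ g ≤ f, 1 ≤ g →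
      a + b + c + d + e + f + g = 12 → [a, b, c, d, e, f, g] ∈ strata7J0 := by
  decide

/-- Soundness at `s = 7`, `j = 0`. -/
theorem census7_j0_sound :
    strata7J0.length = 6 ∧ strata7J0.Nodup ∧
      ∀ l ∈ strata7J0, l.length = 7 ∧ l.Pairwise (· ≥ ·) ∧ (∀ k ∈ l, 1 ≤ k ∧ k ≤ 5) ∧
        l.sum = 12 := by
  decide

/-- The unique root-multiplicity partition at `s = 7`, `j = 1728`: `{1⁶,2}` (`6·III + I₀*`). -/
def strata7J1728 : List (List ℕ) :=
  [[2, 1, 1, 1, 1, 1, 1]]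

/-- Completeness at `s = 7`, `j = 1728`. -/
theorem census7_j1728 :
    ∀ a ≤ 3, ∀ b ≤ a, ∀ c ≤ b, ∀ d ≤ c, ∀ e ≤ d, ∀ f ≤ e, ∀ g ≤ f, 1 ≤ g →
      a + b + c + d + e + f + g = 8 → [a, b, c, d, e, f, g] ∈ strata7J1728 := by
  decide

/-- Soundness at `s = 7`, `j = 1728`. -/
theorem census7_j1728_sound :
    strata7J1728.length = 1 ∧
      ∀ l ∈ strata7J1728, l.length = 7 ∧ l.Pairwise (· ≥ ·) ∧ (∀ k ∈ l, 1 ≤ k ∧ k ≤ 3) ∧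
        l.sum = 8 := by
  decide

/-- Dimension bookkeeping (PROP ISO (c)): a stratum with `s` marked points on `ℙ¹` has `s - 3` moduli and
the very general member has `m = s - 2`, `rk T = 2m`, `ρ = 22 - 2m = 26 - 2s`; at `s = 6`:
`(moduli, m, rk T, ρ) = (3, 4, 8, 14)`, at `s = 7`: `(4, 5, 10, 12)`. -/
theorem dimension_bookkeeping :
    (6 - 3 = 3 ∧ 6 - 2 = 4 ∧ 2 * (6 - 2) = 8 ∧ 26 - 2 * 6 = 14 ∧ 22 - 8 = 14) ∧
    (7 - 3 = 4 ∧ 7 - 2 = 5 ∧ 2 * (7 - 2) = 10 ∧ 26 - 2 * 7 = 12 ∧ 22 - 10 = 12) := by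
  decide

end Summit.HodgeConjecture.HodgeConjecture.Theorems.IsoCensus
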